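import Mathlib
import HarnessLib
import Summits.AtomisticToContinuum.HydrodynamicLimit.Theorems.BoltzmannGreenKubo.Negative.Stationarity

/-!
# Window transfer at equilibrium (constant profiles) — stub `stub_windowTransfer_const`

Equilibrium instance of the window-transfer stub `stub_windowTransfer` of line `Sketch` for the crux
`KineticCurrentsWindowLDUniform` (stmt-AtomisticToContinuum-14662): for CONSTANT profiles the local
Gibbs law is invariant under every hard-sphere flow
(`BoltzmannGreenKuboOrthMomentum.measurePreserving_flow_localGibbsLaw`), so single-time expectations
of non-negative functionals at time `r` equal those at time `0`; the claimed bound holds with `q = 1`,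
`N₀ = 0`, and the slack factor `exp (δ (N+1)) ≥ 1`.
-/

noncomputable section

open MeasureTheory Set Filter
open scoped ENNReal Topology

namespace Summit.AtomisticToContinuum.HydrodynamicLimit.Theorems.KineticCurrentsWindowLDUniformSketch

open Literature.Analysis.FluidPDE (HardSphereFlow Config localMaxwellian)
open Literature.MathematicalPhysics.KineticTheory (T3 V3 hsDiameter localGibbsLaw localGibbsMeasure)

/-- **Window transfer at constant profiles (equilibrium).** For constant profiles `a, u₀, θ₀` the local
Gibbs law `λ^N` is invariant under the hard-sphere flow, hence for every measurable `G ≥ 0` and every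
time `r`, `∫⁻ G ∘ Φ_r dλ = ∫⁻ G dλ ≤ exp (δ (N+1)) · (∫⁻ G ^ 1 dλ) ^ (1/1)`; this is the registered
signature with `q := 1`, `N₀ := 0`. -/
theorem stub_windowTransfer_const :
    ∀ (a θ₀ : ℝ) (u₀ : V3), 0 < a → 0 < θ₀ → ∀ σ : ℝ, 0 < σ → σ ≤ 1 / 2 →
      ∃ q : ℝ, 1 ≤ q ∧ ∀ τ : ℝ, 0 < τ → ∀ δ : ℝ, 0 < δ →
      ∀ Φ : (N : ℕ) →
        HardSphereFlow (Literature.Analysis.FluidPDE.Torus.geometry (Fin 3)) (hsDiameter σ N) (N + 1),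
      ∃ N₀ : ℕ, ∀ N : ℕ, N₀ ≤ N → ∀ r ∈ Set.Icc (0 : ℝ) (τ * ((N : ℝ) + 1) ^ (-(1 / 3 : ℝ))),
      ∀ G : Config (N + 1) (Fin 3) T3 → ℝ≥0∞, Measurable G →
        ∫⁻ z, G ((Φ N).flow r z) ∂(localGibbsLaw σ (fun _ => a) (fun _ => u₀) (fun _ => θ₀) N (Φ N)) ≤
          ENNReal.ofReal (Real.exp (δ * ((N : ℝ) + 1))) *
            (∫⁻ z, G z ^ q ∂(localGibbsLaw σ (fun _ => a) (fun _ => u₀) (fun _ => θ₀) N (Φ N))) ^ (1 / q) := by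
  intro a θ₀ u₀ _ha _hθ σ _hσ _hσ'
  refine ⟨1, le_rfl, ?_⟩
  intro _τ _hτ δ hδ Φ
  refine ⟨0, ?_⟩
  intro N _hN r _hr G hG
  have hmp := BoltzmannGreenKuboOrthMomentum.measurePreserving_flow_localGibbsLaw
    (σ := σ) a θ₀ u₀ (Φ N) r
  rw [hmp.lintegral_comp hG]
  simp only [ENNReal.rpow_one, div_one]
  refine le_mul_of_one_le_left (by simp) ?_
  refine ENNReal.one_le_ofReal.mpr (Real.one_le_exp ?_)
  positivity

end Summit.AtomisticToContinuum.HydrodynamicLimit.Theorems.KineticCurrentsWindowLDUniformSketch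

end
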